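import Summits.HodgeConjecture.HodgeConjecture.Theorems.R90S4HLdsTwoOfDecomposable           -- ★ p862152 (R90-C131-p05); brings ★ p03 `R90S4U2OuterSimilSwap` (`swap_of_two_of_exists_moved`), ★ `continuous_unitsCoe_of_isOpen_ker`, ★ `QuadraticLocalNormGroupNonsplit`
import Summits.HodgeConjecture.HodgeConjecture.Theorems.R90S4U2TwistedCoinvariantsLeOne        -- ★ p862599 (K2E3-p11) (a) `finrank_coinvariants_charTwist_cmPrincipalSeries_two_le_one`
import Summits.HodgeConjecture.HodgeConjecture.Theorems.R90S4U2NoUnipotentTrivialConstituent   -- ★ p862686 (this seat) (f₂) `not_unipotentU_trivial_of_isConstituentOf_cmPrincipalSeries_two`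
import Summits.HodgeConjecture.HodgeConjecture.Theorems.R90S4TwistedSpanTransport              -- ★ p862083 (this seat) (b) `not_nontrivial_coinvariants_iff_twistedSpan_eq_top`
import Summits.HodgeConjecture.HodgeConjecture.Theorems.R90S4DegenerateUnipotentTrivial        -- ★ p862058 (this seat) (e) `apply_eq_self_of_forall_twistedSpan_eq_top`
import Summits.HodgeConjecture.HodgeConjecture.Theorems.R90S4GenericityOrbit                   -- ★ p862814 (this seat) ASM-core: transports + `orbit_contradiction`
import HarnessLib

/-!
# R90-TF · S4 «Ch. 13.1–2» — the (SWAP) ASSEMBLY, hypothesis-first: an OUTER SIMILITUDE MOVES a constituent of `i(χ)` in Keys' case,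
# given the two constituents (TWO) and a one-parameter FRAME of the unipotent radical

Cell `hodgecm-mathlib`, crux H413 (`stmt-HodgeConjecture-24833`, lane `--supports … --as helper`), route of record `HCCMUnconditional`
(no route verbs; count-neutral).  Programme R90-TF (brief `director/R90-BRIEF.v2.md` 1f40d54518340a35), section S4 = Rogawski Ch. 13.1–2
(base `R90-C131`); seat R90-C131-p01 (g0), the `_ldsSwap` ASSEMBLY (dealer RULING S4-R10 (4)), target sub-socket `stub_R90_S4_U2_ldsSwap` of
`Cruxes/H413/Lines/R90_S4_HPacketsU2B.lean` ED. 5 ([Rogawski1990, §11.1 p. 161]: «`JH(i_G(χ))` is an l.d.s. L-packet»).  THEOREMS ONLY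
(no `def`, no instance, no notation, no named fact, no `sorry`); ★-only imports.

THE ARGUMENT ([LabesseLanglands1979, §2]; [Rogawski1990, §11.1 p. 161]).  Let `v` be non-split, `χ₁|F_v^× = ω`, `i(χ) = i_{U(Φ₂)}((χ₁, χ₂))` with
exactly two constituents `π₁ ≠ π₂` (TWO).  Fix a non-trivial continuous additive character `ψ` of `F_v` and a one-parameter FRAME `e : F_v → N`
of the unipotent radical (`N = e(F_v)`), with the characters `θ_c(e y) = ψ(c y)` of `N`.  Say `π` is `c`-GENERIC if `J(π|_N ⊗ θ_c⁻¹) ≠ 0`.  Then: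
(A) for `c ≠ 0` at most one of `π₁, π₂` is `c`-generic — ★ (a) `dim J(i(χ)|_N ⊗ θ_c⁻¹) ≤ 1` + ★ (c) the SLOT LEMMA; (E) each `πᵢ` is `c`-generic for
some `c ≠ 0` — else all its non-trivially twisted coinvariants vanish, so `N` acts trivially (★ (b) bridge + ★ (e) DEGENERATE ⇒ TRIVIAL), which ★ (f₂)
forbids in Keys' case; (I) genericity of `π` at `c` implies genericity at `c · N(z)` (torus conjugation rescales `e`, ★ ASM-core transport);
(T) if the outer similitude `T` (multiplier `a`, NOT a norm) FIXED `π₁`, genericity of `π₁` at `c` would imply genericity at `c·a` (★ ASM-core comap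
transport, `Ad(T) e(y) = e(a y)`); (X) `F_v^× = N E_v^× ⊔ a · N E_v^×` (★ index two).  ★ `orbit_contradiction`: impossible.  Hence `T` MOVES `π₁`,
and ★ p03 `swap_of_two_of_exists_moved` upgrades one mover to (SWAP).

THIS FILE (hypothesis-first; the FRAME is K2E3-p11 (g9)'s `Theorems/R90S4U2UnipotentOneParameter`, consumed by the short closing file once ★):
* `comap_ne_self_of_two_of_frame` — (MOVER): under (TWO) and the FRAME hypotheses, `π₁ ∘ Ad(T) ≠ π₁`.

HONEST LABEL: HC_CM is proved only modulo the 7 printed citations (2 remaining named inputs: hLiu418 = stmt-HodgeConjecture-24832,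
h413 = stmt-HodgeConjecture-24833) until rung 0 closes; (SWAP) is paid by this road only modulo (TWO) (hence modulo (RED)); REL ≠ ★ ≠ BUILT.

## References
[Rogawski1990] J. D. Rogawski, *Automorphic Representations of Unitary Groups in Three Variables* (1990), §11.1 p. 161, Prop. 11.1.1; §12.1 p. 171 ·
[LabesseLanglands1979] J.-P. Labesse, R. P. Langlands, *L-indistinguishability for SL(2)*, Canad. J. Math. 31 (1979), §2 ·
[BernsteinZelevinskyASENS1977] I. N. Bernstein, A. V. Zelevinsky, Ann. Sci. ÉNS 10 (1977), §1.8 (b), Prop. 1.9 (a), Thm. 5.2.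
-/

set_option autoImplicit false
-- the mandated namespace (brief §3.4) repeats the single-problem summit's segment (`HodgeConjecture.HodgeConjecture`)
set_option linter.dupNamespace false

noncomputable section

open NumberField IsDedekindDomain
open scoped MatrixGroups
open Representation Literature.NumberTheory.Automorphic Literature.NumberTheory.Automorphic.UnitaryGroup
open Literature.NumberTheory.Automorphic.TwistedJacquet

namespace Summit.HodgeConjecture.HodgeConjecture.R90.S4

variable (L : Type) [Field L] [NumberField L] [IsCMField L]

set_option synthInstance.maxHeartbeats 400000 in  -- instance paths on the CM carrier `∏_{w ∣ v} L_w`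
set_option maxHeartbeats 4000000 in  -- class-level bookkeeping on the CM carrier (no Jacquet calculus here: ★ ASM-core is generic)
/-- **(MOVER) — an outer similitude MOVES a constituent of `i(χ)` in Keys' case**, hypothesis-first over a one-parameter FRAME of `N`.  Data: `v` non-split,
`χ₁, χ₂` smooth with `χ₁|F_v^× = ω`; the two constituents `π₁ ≠ π₂` of `i(χ)` (TWO); a non-trivial continuous additive character `ψ` of `F_v`;
a FRAME `e : F_v → N` (additive, onto `N`, every smooth irreducible acts smoothly along it) with the characters `θ_c` of `N`, `θ_c(e y) = ψ(c y)`
(open kernels); TORUS RESCALING: every unit `z` of `E_v` gives `g ∈ G₂`, `n ∈ F_v` with `ι n = z̄ z` and `g⁻¹ e(y) g = e(n y)`; an OUTER SIMILITUDE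
`T` (`ᵗT̄ Φ₂ T = a_R Φ₂`, `a_R = ι a` NOT a norm) with `Ad(T) e(y) = e(a y)`.  Conclusion: `π₁ ∘ Ad(T) ≠ π₁`.  See the module docstring for the proof
((A) ★ (a) + ★ (c); (E) ★ (b) + ★ (e) + ★ (f₂); (I)(T) ★ ASM-core transports; (X) ★ index two; ★ `orbit_contradiction`).
[cite: Rogawski1990, §11.1 p. 161] [cite: LabesseLanglands1979, §2] [cite: BernsteinZelevinskyASENS1977, Prop. 1.9 (a)] -/
theorem comap_ne_self_of_two_of_frame (v : HeightOneSpectrum (𝓞 ↥(maximalRealSubfield L)))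
    (hns : ∀ w : PlacesOver L v, IsCMField.complexConj L • w.1 = w.1)
    (χ₁ : (LocalRing L v)ˣ →* ℂˣ) (χ₂ : ↥(normOneUnits (conjLocal L (IsCMField.complexConj L) v)) →* ℂˣ)
    (hχ₁ : IsOpen ((χ₁.ker : Subgroup (LocalRing L v)ˣ) : Set (LocalRing L v)ˣ))
    (hχ₂ : IsOpen ((χ₂.ker : Subgroup ↥(normOneUnits (conjLocal L (IsCMField.complexConj L) v))) :
      Set ↥(normOneUnits (conjLocal L (IsCMField.complexConj L) v))))
    (hq : IsQuadraticCharExtension (conjLocal L (IsCMField.complexConj L) v) χ₁)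
    {π₁ π₂ : IrrClass ((cmDatum L 2 (Matrix.of fun i j : Fin 2 => if i.val + j.val + 1 = 2 then (1 : L) else 0)).Local v)}
    (hne : π₁ ≠ π₂)
    (hcons : ∀ c : IrrClass ((cmDatum L 2 (Matrix.of fun i j : Fin 2 => if i.val + j.val + 1 = 2 then (1 : L) else 0)).Local v),
      c.IsConstituentOf (cmPrincipalSeries L 2 v
        (torusCharPair (conjLocal L (IsCMField.complexConj L) v) (cmLocalForm L 2 v) (cmLocalForm_eq_over L 2 v) 0 χ₁ χ₂)) ↔ c = π₁ ∨ c = π₂)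
    -- the FRAME
    (ψ : AddChar (v.adicCompletion ↥(maximalRealSubfield L)) Circle) (hψ : ψ.IsContinuousNontrivial)
    (e : v.adicCompletion ↥(maximalRealSubfield L) → ↥(unitaryGroupOfForm (conjLocal L (IsCMField.complexConj L) v) (cmLocalForm L 2 v)))
    (he : ∀ x y, e (x + y) = e x * e y) (heN : ∀ x, e x ∈ (cmBorelTriple L 2 v).N) (hNe : ∀ n ∈ (cmBorelTriple L 2 v).N, ∃ x, e x = n)
    (hsm : ∀ {V : Type} [AddCommGroup V] [Module ℂ V] (ρ : Representation ℂ ↥(unitaryGroupOfForm (conjLocal L (IsCMField.complexConj L) v) (cmLocalForm L 2 v)) V), ρ.IsSmooth →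
      ∀ w : V, ∃ s : v.adicCompletion ↥(maximalRealSubfield L), s ≠ 0 ∧ ∀ x ∈ ball s, ρ (e x) w = w)
    (θ : v.adicCompletion ↥(maximalRealSubfield L) → (↥(cmBorelTriple L 2 v).N →* ℂˣ))
    (hθo : ∀ c, IsOpen (((θ c).ker : Subgroup ↥(cmBorelTriple L 2 v).N) : Set ↥(cmBorelTriple L 2 v).N))
    (hθv : ∀ c x, ((θ c ⟨e x, heN x⟩ : ℂˣ) : ℂ) = (ψ (c * x) : ℂ))
    (hconj : ∀ z : LocalRing L v, IsUnit z →
      ∃ (g : ↥(unitaryGroupOfForm (conjLocal L (IsCMField.complexConj L) v) (cmLocalForm L 2 v))) (n : v.adicCompletion ↥(maximalRealSubfield L)),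
        toLocalRing L v n = conjLocal L (IsCMField.complexConj L) v z * z ∧ ∀ y, g⁻¹ * e y * g = e (n * y))
    -- the outer similitude
    (T : GL (Fin 2) (LocalRing L v)) {aR : LocalRing L v} (haR : IsUnit aR)
    (hT : formCongr (conjLocal L (IsCMField.complexConj L) v) T
      ((Matrix.of fun i j : Fin 2 => if i.val + j.val + 1 = 2 then (1 : L) else 0).map (algebraMap L (LocalRing L v))) =
      aR • (Matrix.of fun i j : Fin 2 => if i.val + j.val + 1 = 2 then (1 : L) else 0).map (algebraMap L (LocalRing L v)))
    (haN : ¬ ∃ z : LocalRing L v, IsUnit z ∧ aR = conjLocal L (IsCMField.complexConj L) v z * z)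
    (a : v.adicCompletion ↥(maximalRealSubfield L)) (haι : toLocalRing L v a = aR)
    (hTe : ∀ y, cmDatumLocalCongr L v T haR hT (e y) = e (a * y)) :
    IrrClass.comap (cmDatumLocalCongr L v T haR hT) π₁ ≠ π₁ := by
  intro hfix
  haveI := locallyCompactSpace_cmBorelU L 2 v
  have h₁ := continuous_unitsCoe_of_isOpen_ker χ₁ hχ₁
  have h₂ := continuous_unitsCoe_of_isOpen_ker χ₂ hχ₂
  have hN := isLimitOfCompactOpen_cmBorelTriple_N L 2 v
  have hIsm : (cmPrincipalSeries L 2 v (torusCharPair (conjLocal L (IsCMField.complexConj L) v) (cmLocalForm L 2 v) (cmLocalForm_eq_over L 2 v) 0 χ₁ χ₂)).IsSmooth := by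
    unfold cmPrincipalSeries principalSeries Representation.normalizedInd
    exact Representation.isSmooth_smoothInd (cmBorelTriple L 2 v).P _
  have hNe' : ∀ n : ↥(cmBorelTriple L 2 v).N, ∃ x, e x = n := fun n => hNe n n.2
  -- representatives of the two constituents
  obtain ⟨r₁, hr₁⟩ : ∃ r : SmoothIrrep ↥(unitaryGroupOfForm (conjLocal L (IsCMField.complexConj L) v) (cmLocalForm L 2 v)), (IrrClass.mk r : IrrClass ((cmDatum L 2 (Matrix.of fun i j : Fin 2 => if i.val + j.val + 1 = 2 then (1 : L) else 0)).Local v)) = π₁ :=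
    IrrClass.mk_surjective π₁
  obtain ⟨r₂, hr₂⟩ : ∃ r : SmoothIrrep ↥(unitaryGroupOfForm (conjLocal L (IsCMField.complexConj L) v) (cmLocalForm L 2 v)), (IrrClass.mk r : IrrClass ((cmDatum L 2 (Matrix.of fun i j : Fin 2 => if i.val + j.val + 1 = 2 then (1 : L) else 0)).Local v)) = π₂ :=
    IrrClass.mk_surjective π₂
  have hc₁ : (IrrClass.mk r₁).IsConstituentOf (cmPrincipalSeries L 2 v
      (torusCharPair (conjLocal L (IsCMField.complexConj L) v) (cmLocalForm L 2 v) (cmLocalForm_eq_over L 2 v) 0 χ₁ χ₂)) :=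
    (hcons _).2 (Or.inl hr₁)
  have hc₂ : (IrrClass.mk r₂).IsConstituentOf (cmPrincipalSeries L 2 v
      (torusCharPair (conjLocal L (IsCMField.complexConj L) v) (cmLocalForm L 2 v) (cmLocalForm_eq_over L 2 v) 0 χ₁ χ₂)) :=
    (hcons _).2 (Or.inr hr₂)
  have hne12 : IrrClass.mk r₁ ≠ IrrClass.mk r₂ := fun h => hne (hr₁.symm.trans (h.trans hr₂))
  -- `ψ` is non-trivial somewhere; `θ_c ≠ 1` for `c ≠ 0`
  obtain ⟨y₀, hy₀⟩ : ∃ y₀, ψ y₀ ≠ 1 := by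
    obtain ⟨y₀, hy₀⟩ := DFunLike.ne_iff.1 hψ.2
    exact ⟨y₀, by rwa [AddChar.zero_apply] at hy₀⟩
  have hθ1 : ∀ c, c ≠ 0 → θ c ≠ 1 := by
    intro c hc h1
    apply hy₀
    have h := hθv c (y₀ / c)
    rw [h1, MonoidHom.one_apply, Units.val_one, mul_div_cancel₀ _ hc] at h
    exact Circle.ext h.symm
  -- (A) the slot: at most one of `r₁, r₂` is `c`-generic
  have hA : ∀ c, c ≠ 0 → ¬ (Nontrivial (r₁.ρ.charTwist (cmBorelTriple L 2 v).N (θ c)).Coinvariants ∧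
      Nontrivial (r₂.ρ.charTwist (cmBorelTriple L 2 v).N (θ c)).Coinvariants) := by
    rintro c hc ⟨hg₁, hg₂⟩
    obtain ⟨hfin, hle⟩ := finrank_coinvariants_charTwist_cmPrincipalSeries_two_le_one L v hns _ (θ c) (hθo c) (hθ1 c hc)
    haveI := hfin
    haveI := hg₁
    exact not_nontrivial_coinvariants_charTwist_of_ne (cmBorelTriple L 2 v).N (θ c) hN (hθo c) hIsm hle hne12 hc₁ hc₂ hg₂
  -- (E) each constituent is `c`-generic for some `c ≠ 0`
  have hE : ∀ r : SmoothIrrep ↥(unitaryGroupOfForm (conjLocal L (IsCMField.complexConj L) v) (cmLocalForm L 2 v)),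
      (IrrClass.mk r).IsConstituentOf (cmPrincipalSeries L 2 v
        (torusCharPair (conjLocal L (IsCMField.complexConj L) v) (cmLocalForm L 2 v) (cmLocalForm_eq_over L 2 v) 0 χ₁ χ₂)) →
      ∃ c, c ≠ 0 ∧ Nontrivial (r.ρ.charTwist (cmBorelTriple L 2 v).N (θ c)).Coinvariants := by
    intro r hr
    by_contra hnone
    have hnone' : ∀ c, c ≠ 0 → ¬ Nontrivial (r.ρ.charTwist (cmBorelTriple L 2 v).N (θ c)).Coinvariants :=
      fun c hc hnt => hnone ⟨c, hc, hnt⟩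
    have hdeg : ∀ c, c ≠ 0 → twistedSpan r.ρ e ψ c = ⊤ := fun c hc =>
      (not_nontrivial_coinvariants_iff_twistedSpan_eq_top r.ρ ψ (cmBorelTriple L 2 v).N (θ c) e heN hNe' c (hθv c)).1 (hnone' c hc)
    refine not_unipotentU_trivial_of_isConstituentOf_cmPrincipalSeries_two L v hns χ₁ χ₂ h₁ h₂ hq r hr fun n hn => ?_
    obtain ⟨y, rfl⟩ := hNe n hn
    exact LinearMap.ext fun w => by
      rw [Module.End.one_apply]
      exact apply_eq_self_of_forall_twistedSpan_eq_top he (hsm r.ρ r.isSmooth) hψ hdeg y w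
  -- values of `θ_c` on `N` determine it: a comparison lemma
  have hθeq : ∀ (c c' : v.adicCompletion ↥(maximalRealSubfield L)) (m m' : ↥(cmBorelTriple L 2 v).N) (y : v.adicCompletion ↥(maximalRealSubfield L)),
      (m : ↥(unitaryGroupOfForm (conjLocal L (IsCMField.complexConj L) v) (cmLocalForm L 2 v))) = e y →
      ∀ y', (m' : ↥(unitaryGroupOfForm (conjLocal L (IsCMField.complexConj L) v) (cmLocalForm L 2 v))) = e y' →
      c * y = c' * y' → θ c m = θ c' m' := by
    intro c c' m m' y hm y' hm' hyy
    have hm1 : m = ⟨e y, heN y⟩ := Subtype.ext hm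
    have hm2 : m' = ⟨e y', heN y'⟩ := Subtype.ext hm'
    subst hm1 hm2
    exact Units.ext (by rw [hθv, hθv, hyy])
  -- (I) torus rescaling: `c`-generic ⇒ `c·n`-generic for every norm `ι n = z̄ z`
  have hI : ∀ (c n : v.adicCompletion ↥(maximalRealSubfield L)),
      (∃ z : LocalRing L v, IsUnit z ∧ toLocalRing L v n = conjLocal L (IsCMField.complexConj L) v z * z) →
      Nontrivial (r₁.ρ.charTwist (cmBorelTriple L 2 v).N (θ c)).Coinvariants →
      Nontrivial (r₁.ρ.charTwist (cmBorelTriple L 2 v).N (θ (c * n))).Coinvariants := by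
    rintro c n ⟨z, hz, hzn⟩ hgen
    obtain ⟨g, n', hn', hg⟩ := hconj z hz
    have hnn : n' = n := toLocalRing_injective L v (hn'.trans hzn.symm)
    subst hnn
    have hx : ∀ m : ↥(cmBorelTriple L 2 v).N,
        g⁻¹ * (m : ↥(unitaryGroupOfForm (conjLocal L (IsCMField.complexConj L) v) (cmLocalForm L 2 v))) * g ∈ (cmBorelTriple L 2 v).N := by
      intro m
      obtain ⟨y, hy⟩ := hNe' m
      rw [← hy, hg]
      exact heN _
    refine nontrivial_coinvariants_charTwist_of_conj r₁.ρ (cmBorelTriple L 2 v).N (θ (c * n')) (θ c) g hx (fun m => ?_) hgen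
    obtain ⟨y, hy⟩ := hNe' m
    exact hθeq c (c * n') _ m (n' * y)
      (show g⁻¹ * (m : ↥(unitaryGroupOfForm (conjLocal L (IsCMField.complexConj L) v) (cmLocalForm L 2 v))) * g = e (n' * y) by
        rw [← hy, hg]) y hy.symm (by ring)
  -- (T) the outer similitude: if `π₁ ∘ Ad(T) = π₁` then `c`-generic ⇒ `c·a`-generic
  have ha0 : a ≠ 0 := by
    rintro rfl
    rw [map_zero] at haι
    exact not_isUnit_zero (haι ▸ haR)
  have hφe : ∀ y, ((cmDatumLocalCongr L v T haR hT : (cmDatum L 2 (Matrix.of fun i j : Fin 2 => if i.val + j.val + 1 = 2 then (1 : L) else 0)).Local v →* (cmDatum L 2 (Matrix.of fun i j : Fin 2 => if i.val + j.val + 1 = 2 then (1 : L) else 0)).Local v) (e y) :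
      ↥(unitaryGroupOfForm (conjLocal L (IsCMField.complexConj L) v) (cmLocalForm L 2 v))) = e (a * y) := fun y => hTe y
  have hφN : ∀ n : ↥(cmBorelTriple L 2 v).N,
      ((cmDatumLocalCongr L v T haR hT : (cmDatum L 2 (Matrix.of fun i j : Fin 2 => if i.val + j.val + 1 = 2 then (1 : L) else 0)).Local v →* (cmDatum L 2 (Matrix.of fun i j : Fin 2 => if i.val + j.val + 1 = 2 then (1 : L) else 0)).Local v) (n : ↥(unitaryGroupOfForm (conjLocal L (IsCMField.complexConj L) v) (cmLocalForm L 2 v))) : ↥(unitaryGroupOfForm (conjLocal L (IsCMField.complexConj L) v) (cmLocalForm L 2 v))) ∈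
        (cmBorelTriple L 2 v).N := by
    intro n
    obtain ⟨y, hy⟩ := hNe' n
    rw [← hy, hφe]
    exact heN _
  have hsurjφ : ∀ m : ↥(cmBorelTriple L 2 v).N, ∃ n : ↥(cmBorelTriple L 2 v).N,
      ((cmDatumLocalCongr L v T haR hT : (cmDatum L 2 (Matrix.of fun i j : Fin 2 => if i.val + j.val + 1 = 2 then (1 : L) else 0)).Local v →* (cmDatum L 2 (Matrix.of fun i j : Fin 2 => if i.val + j.val + 1 = 2 then (1 : L) else 0)).Local v) (n : ↥(unitaryGroupOfForm (conjLocal L (IsCMField.complexConj L) v) (cmLocalForm L 2 v))) : ↥(unitaryGroupOfForm (conjLocal L (IsCMField.complexConj L) v) (cmLocalForm L 2 v))) = (m : ↥(unitaryGroupOfForm (conjLocal L (IsCMField.complexConj L) v) (cmLocalForm L 2 v))) := by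
    intro m
    obtain ⟨y, hy⟩ := hNe' m
    refine ⟨⟨e (a⁻¹ * y), heN _⟩, ?_⟩
    rw [hφe, ← mul_assoc, mul_inv_cancel₀ ha0, one_mul, hy]
  have hT' : ∀ c, Nontrivial (r₁.ρ.charTwist (cmBorelTriple L 2 v).N (θ c)).Coinvariants →
      Nontrivial (r₁.ρ.charTwist (cmBorelTriple L 2 v).N (θ (c * a))).Coinvariants := by
    intro c hgen
    -- `⟦r₁ ∘ Ad(T)⟧ = ⟦r₁⟧`
    have hmk : IrrClass.mk (r₁.comap (cmDatumLocalCongr L v T haR hT)) = IrrClass.mk r₁ :=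
      (IrrClass.comap_mk (cmDatumLocalCongr L v T haR hT) r₁).symm.trans
        (((congrArg (IrrClass.comap (cmDatumLocalCongr L v T haR hT)) hr₁).trans hfix).trans hr₁.symm)
    -- `θ_c (Ad(T) n) = θ_{c a} (n)` on `N`
    have hθ' : ∀ n : ↥(cmBorelTriple L 2 v).N, θ c ⟨_, hφN n⟩ = θ (c * a) n := by
      intro n
      obtain ⟨y, hy⟩ := hNe' n
      exact hθeq c (c * a) _ n (a * y)
        (show ((cmDatumLocalCongr L v T haR hT : (cmDatum L 2 (Matrix.of fun i j : Fin 2 => if i.val + j.val + 1 = 2 then (1 : L) else 0)).Local v →* (cmDatum L 2 (Matrix.of fun i j : Fin 2 => if i.val + j.val + 1 = 2 then (1 : L) else 0)).Local v) (n : ↥(unitaryGroupOfForm (conjLocal L (IsCMField.complexConj L) v) (cmLocalForm L 2 v))) : ↥(unitaryGroupOfForm (conjLocal L (IsCMField.complexConj L) v) (cmLocalForm L 2 v))) = e (a * y) by rw [← hy, hφe]) y hy.symm (by ring)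
    -- comap transport (★ ASM-core §2), then class invariance (★ ASM-core §1)
    have h2 : Nontrivial (Representation.charTwist (r₁.ρ.comp (cmDatumLocalCongr L v T haR hT : (cmDatum L 2 (Matrix.of fun i j : Fin 2 => if i.val + j.val + 1 = 2 then (1 : L) else 0)).Local v →* (cmDatum L 2 (Matrix.of fun i j : Fin 2 => if i.val + j.val + 1 = 2 then (1 : L) else 0)).Local v))
        (cmBorelTriple L 2 v).N (θ (c * a))).Coinvariants :=
      (nontrivial_coinvariants_charTwist_comp_iff r₁.ρ (cmDatumLocalCongr L v T haR hT : (cmDatum L 2 (Matrix.of fun i j : Fin 2 => if i.val + j.val + 1 = 2 then (1 : L) else 0)).Local v →* (cmDatum L 2 (Matrix.of fun i j : Fin 2 => if i.val + j.val + 1 = 2 then (1 : L) else 0)).Local v) (cmBorelTriple L 2 v).N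
        (cmBorelTriple L 2 v).N (θ (c * a)) (θ c) hφN hsurjφ hθ').2 hgen
    exact nontrivial_coinvariants_charTwist_of_mk_eq (cmBorelTriple L 2 v).N (θ (c * a)) hmk h2
  -- (X) index two, in `F_v`-parameters
  have hX : ∀ c₁ c₂ : v.adicCompletion ↥(maximalRealSubfield L), c₁ ≠ 0 → c₂ ≠ 0 →
      ∃ n, (∃ z : LocalRing L v, IsUnit z ∧ toLocalRing L v n = conjLocal L (IsCMField.complexConj L) v z * z) ∧
        (c₂ = c₁ * n ∨ c₂ = c₁ * a * n) := by
    intro c₁ c₂ hc₁ hc₂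
    obtain ⟨δ, hcδ, hδ⟩ := Literature.NumberTheory.Weil1982.UnitaryFinTopForm.exists_complexConj_eq_neg_ne_zero L
    obtain ⟨w⟩ : Nonempty (PlacesOver L v) := inferInstance
    have hu : IsUnit (toLocalRing L v (c₂ / c₁)) := (isUnit_iff_ne_zero.2 (div_ne_zero hc₂ hc₁)).map _
    have hσu : conjLocal L (IsCMField.complexConj L) v (toLocalRing L v (c₂ / c₁)) = toLocalRing L v (c₂ / c₁) :=
      conjLocal_toLocalRing (IsCMField.complexConj L) v _
    by_cases hnrm : ∃ z : LocalRing L v, IsUnit z ∧ toLocalRing L v (c₂ / c₁) = conjLocal L (IsCMField.complexConj L) v z * z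
    · exact ⟨c₂ / c₁, hnrm, Or.inl (by field_simp)⟩
    · have haσ : conjLocal L (IsCMField.complexConj L) v aR = aR := by rw [← haι]; exact conjLocal_toLocalRing (IsCMField.complexConj L) v a
      obtain ⟨z, hz, hzz⟩ := exists_norm_mul_of_not_exists_norm L v (IsCMField.complexConj L) hcδ hδ w (hns w) haσ haR hσu hu haN hnrm
      refine ⟨c₂ / (c₁ * a), ⟨z, hz, ?_⟩, Or.inr (by field_simp)⟩
      have key : toLocalRing L v (c₂ / (c₁ * a)) * aR = conjLocal L (IsCMField.complexConj L) v z * z * aR := by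
        rw [← hzz, ← haι, ← map_mul]
        congr 1
        field_simp
      exact haR.mul_left_inj.1 key
  -- the orbit argument
  exact orbit_contradiction
    (fun c => Nontrivial (r₁.ρ.charTwist (cmBorelTriple L 2 v).N (θ c)).Coinvariants)
    (fun c => Nontrivial (r₂.ρ.charTwist (cmBorelTriple L 2 v).N (θ c)).Coinvariants)
    (fun n => ∃ z : LocalRing L v, IsUnit z ∧ toLocalRing L v n = conjLocal L (IsCMField.complexConj L) v z * z)
    a hA (hE r₁ hc₁) (hE r₂ hc₂) (fun c n hn hg => hI c n hn hg) hT' hX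

end Summit.HodgeConjecture.HodgeConjecture.R90.S4

end
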